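import Mathlib
import HarnessLib
import Literature.Analysis.Calculus.IteratedDerivCompGeometric
import Literature.MathematicalPhysics.QuantumLattice.HubbardUVSymbolFibreSampling

/-!
# Sampled mixed differences of `g(ω, u(p⃗))·κ(p⃗)` and of a band INCREMENT with GEOMETRIC (multi-scale) constants

Topic `MathematicalPhysics/QuantumLattice`; the sharp companion of `HubbardUVSymbolFibreSampling` §4.  There the sampled Faà di Bruno / Leibniz /
band-increment bounds carry ONE-SCALE constants: a fibrewise envelope `‖Dⁱg‖ ≤ C·E(ω)` uniform over the orders `i ≤ k` and PURE-POWER band jets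
`‖Dⁱũ‖ ≤ Dⁱ`.  For the frame-shift response of the two-leg reading at a deep scale `Λ_n` (cell gate-hubbard-kl, K3 engine-flow stub (C) door (B);
Benfatto–Giuliani–Mastropietro 2006, (2.36aa), §3 (3.2)–(3.8)) the symbol jets grow like `i!·ρⁱ`, `ρ ≍ 1/Λ_n`, and the renormalised band has
`‖Dⁱe_K‖ ≲ 7` for `i ≤ 2` but `≍ Λ_n^{−(i−2)}` beyond — both GEOMETRIC with the common ratio `ρ` — and the one-scale reading loses powers of `ρ`.  With the
rescaled Faà di Bruno bound `Literature/Analysis/Calculus/IteratedDerivCompGeometric` (`‖Dⁱg‖ ≤ A·i!·ρⁱ`, `‖Dⁱu‖ ≤ d·ρ^{i−1}` ⇒ `‖Dⁿ(g∘u)‖ ≤ n!·(A·n!)·(max(d,1)ρ)ⁿ`):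

* `norm_iteratedFDeriv_comp_fbPt_mul_le_of_geometric` — `‖Dᵇ(p ↦ g(ω, u p)·κ p)(x)‖ ≤ Σ_{j≤b} C(b,j)·(j!·(A·j!)·(max(d,1)ρ)ʲ)·W_{b−j}`;
* `norm_fwdDiff_iter₂_comp_mul_sample_le_of_geometric` — the sampled form on `(ℤ/L)²` (`×(2π/L)^{a+b}`);
* **`norm_fwdDiff_iter₂_increment_sample_le_of_geometric`** — the band INCREMENT `g(ω, v + w) − g(ω, v)` through the interpolation `v + s·w`:
  `‖Δ_{e_l}^aΔ_{e_{l'}}^b[g(ω, v+w)](q) − Δ_{e_l}^aΔ_{e_{l'}}^b[g(ω, v)](q)‖ ≤ (2π/L)^k·Σ_{j≤k} C(k,j)·(j!·(A·j!)·(max(d,1)ρ)ʲ)·W_{k−j}` (`k = a + b`), ONE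
  jet of the increment `w` per term, when the band derivative `∂_{e₁}g` has geometric jets `A·i!·ρⁱ` on the fibre `{ω} × ℝ` and the interpolated bands
  have jets `d·ρ^{i−1}`.

Everything is proved; no definitions; no named facts.

## Sources

G. Benfatto, A. Giuliani, V. Mastropietro, Ann. Henri Poincaré 7 (2006) 809–898, §2.1 (2.36aa), Lemma 2.2, §3 (3.2)–(3.8)
(`BenfattoGiulianiMastropietro2006`).
-/

noncomputable section

namespace Literature.MathematicalPhysics.QuantumLattice

open Literature.Probability.LatticeModels Literature.Analysis.Calculus Set Complex Filter
open scoped Nat Topology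

/-! ### §1 The composition bound through the band line with geometric constants -/

section Composition

variable {E : Type*} [NormedAddCommGroup E] [NormedSpace ℝ E]

/-- **Geometric Faà di Bruno–Leibniz through the band line**: for `g` with `‖Dⁱg(ω, u x)‖ ≤ A·i!·ρⁱ` (`i ≤ b`), a band `u` with
`‖Dⁱu(x)‖ ≤ d·ρ^{i−1}` (`1 ≤ i ≤ b`) and a factor `κ` with `‖Dⁱκ(x)‖ ≤ Wᵢ`,
`‖Dᵇ(p ↦ g(ω, u p)·κ p)(x)‖ ≤ Σ_{j≤b} C(b,j)·(j!·(A·j!)·(max(d,1)ρ)ʲ)·W_{b−j}`. [cite: BenfattoGiulianiMastropietro2006, §3 (3.2)] -/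
theorem norm_iteratedFDeriv_comp_fbPt_mul_le_of_geometric {g : FreqBand → ℂ} {b : ℕ} (hg : ContDiff ℝ b g) {u κ : E → ℝ}
    (hu : ContDiff ℝ b u) (hκ : ContDiff ℝ b κ) (ω : ℝ) (x : E) {A ρ d : ℝ} (hρ : 0 < ρ)
    (hC : ∀ i ≤ b, ‖iteratedFDeriv ℝ i g (fbPt ω (u x))‖ ≤ A * i ! * ρ ^ i)
    (hD : ∀ i, 1 ≤ i → i ≤ b → ‖iteratedFDeriv ℝ i u x‖ ≤ d * ρ ^ (i - 1))
    {W : ℕ → ℝ} (hW : ∀ i ≤ b, ‖iteratedFDeriv ℝ i κ x‖ ≤ W i) :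
    ‖iteratedFDeriv ℝ b (fun p => g (fbPt ω (u p)) * ((κ p : ℝ) : ℂ)) x‖ ≤
      ∑ j ∈ Finset.range (b + 1), (b.choose j : ℝ) * (j ! * (A * j !) * (max d 1 * ρ) ^ j) * W (b - j) := by
  have hf : ContDiff ℝ b (fun p => fbPt ω (u p)) := contDiff_fbPt_comp hu ω
  have hκ' : ContDiff ℝ b (fun p => ((κ p : ℝ) : ℂ)) := Complex.ofRealCLM.contDiff.comp hκ
  have hD' : ∀ i, 1 ≤ i → i ≤ b → ‖iteratedFDeriv ℝ i (fun p => fbPt ω (u p)) x‖ ≤ d * ρ ^ (i - 1) := by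
    intro i hi1 hi2
    rw [norm_iteratedFDeriv_fbPt_comp hi1 (hu.of_le (by exact_mod_cast hi2)) ω x]
    exact hD i hi1 hi2
  have hW' : ∀ i ≤ b, ‖iteratedFDeriv ℝ i (fun p => ((κ p : ℝ) : ℂ)) x‖ ≤ W i := by
    intro i hi
    have hκi : ContDiffAt ℝ (i : WithTop ℕ∞) κ x := (hκ.of_le (by exact_mod_cast hi)).contDiffAt
    rw [show (fun p => ((κ p : ℝ) : ℂ)) = Complex.ofRealLI ∘ κ from rfl, Complex.ofRealLI.norm_iteratedFDeriv_comp_left hκi le_rfl]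
    exact hW i hi
  exact norm_iteratedFDeriv_comp_mul_le_of_geometric (g := g) (f := fun p => fbPt ω (u p)) (κ := fun p => ((κ p : ℝ) : ℂ))
    hg hf hκ' le_rfl x hρ hC hD' hW'

end Composition

/-! ### §2 The sampled forms on `(ℤ/L)²` -/

section Sampling

variable {L : ℕ} [NeZero L]

/-- **Sampled geometric Leibniz–Faà di Bruno**: with the hypotheses of `norm_iteratedFDeriv_comp_fbPt_mul_le_of_geometric` at EVERY point of the
momentum plane (`u`, `κ` periodic), `‖Δ_{e_l}^aΔ_{e_{l'}}^b[y ↦ g(ω, u(p_y))·κ(p_y)](q)‖ ≤ (2π/L)^{a+b}·Σ_{j≤a+b} C(a+b,j)·(j!·(A·j!)·(max(d,1)ρ)ʲ)·W_{a+b−j}`.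
[cite: BenfattoGiulianiMastropietro2006, (2.36aa) and §3 (3.2)] -/
theorem norm_fwdDiff_iter₂_comp_mul_sample_le_of_geometric {g : FreqBand → ℂ} {a b : ℕ} (hg : ContDiff ℝ (↑(a + b : ℕ)) g)
    {u κ : EuclideanSpace ℝ (Fin 2) → ℝ} (hu : ContDiff ℝ (↑(a + b : ℕ)) u) (hκ : ContDiff ℝ (↑(a + b : ℕ)) κ)
    (hperu : ∀ (p : Fin 2 → ℝ) (z : Fin 2 → ℤ), u (WithLp.toLp 2 (fun i => p i + z i * (2 * Real.pi))) = u (WithLp.toLp 2 p))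
    (hperκ : ∀ (p : Fin 2 → ℝ) (z : Fin 2 → ℤ), κ (WithLp.toLp 2 (fun i => p i + z i * (2 * Real.pi))) = κ (WithLp.toLp 2 p))
    (ω : ℝ) {A ρ d : ℝ} (hρ : 0 < ρ)
    (hC : ∀ x, ∀ i ≤ a + b, ‖iteratedFDeriv ℝ i g (fbPt ω (u x))‖ ≤ A * i ! * ρ ^ i)
    (hD : ∀ i, 1 ≤ i → i ≤ a + b → ∀ x, ‖iteratedFDeriv ℝ i u x‖ ≤ d * ρ ^ (i - 1))
    {W : ℕ → ℝ} (hW : ∀ i ≤ a + b, ∀ x, ‖iteratedFDeriv ℝ i κ x‖ ≤ W i) (l l' : Fin 2) (q : TorusSite 2 L) :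
    ‖(_root_.fwdDiff (Pi.single l (1 : ZMod L) : TorusSite 2 L))^[a]
        ((_root_.fwdDiff (Pi.single l' (1 : ZMod L) : TorusSite 2 L))^[b]
          (fun y => g (fbPt ω (u (WithLp.toLp 2 (latticeMomentum L y)))) * ((κ (WithLp.toLp 2 (latticeMomentum L y)) : ℝ) : ℂ))) q‖ ≤
      (2 * Real.pi / L) ^ (a + b) *
        ∑ j ∈ Finset.range (a + b + 1), ((a + b).choose j : ℝ) * (j ! * (A * j !) * (max d 1 * ρ) ^ j) * W (a + b - j) := by
  have hK : ∀ x, ‖iteratedFDeriv ℝ (a + b) (fun p => g (fbPt ω (u p)) * ((κ p : ℝ) : ℂ)) x‖ ≤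
      ∑ j ∈ Finset.range (a + b + 1), ((a + b).choose j : ℝ) * (j ! * (A * j !) * (max d 1 * ρ) ^ j) * W (a + b - j) :=
    fun x => norm_iteratedFDeriv_comp_fbPt_mul_le_of_geometric hg hu hκ ω x hρ (hC x) (fun i hi1 hi2 => hD i hi1 hi2 x)
      (fun i hi => hW i hi x)
  have hperΦ : PlanePeriodic (fun p : Fin 2 → ℝ => g (fbPt ω (u (WithLp.toLp 2 p))) * ((κ (WithLp.toLp 2 p) : ℝ) : ℂ)) :=
    fun p z => by simp only [hperu, hperκ]
  have hcd : ContDiff ℝ (↑(a + b : ℕ)) (fun p => g (fbPt ω (u p)) * ((κ p : ℝ) : ℂ)) :=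
    (hg.comp (contDiff_fbPt_comp hu ω)).mul (Complex.ofRealCLM.contDiff.comp hκ)
  have h := norm_fwdDiff_iter₂_sample_le (L := L) (fun p => g (fbPt ω (u p)) * ((κ p : ℝ) : ℂ)) hperΦ hcd hK l l' q
  rw [mul_comm] at h
  exact h

/-- **Sampled band INCREMENT with geometric constants**: for lattice bands `v = ṽ∘p`, `w = w̃∘p` with `‖Dⁱ(ṽ + s·w̃)‖ ≤ d·ρ^{i−1}`
(`1 ≤ i ≤ k`, all `s ∈ [0,1]`), `‖Dⁱw̃‖ ≤ Wᵢ` (`i ≤ k`), and `g ∈ C^{k+1}` whose band derivative `∂_{e₁}g` has geometric jets `‖Dⁱ(∂_{e₁}g)(ω, e)‖ ≤ A·i!·ρⁱ`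
(`i ≤ k`) on the whole fibre `{ω} × ℝ`:
`‖Δ_{e_l}^aΔ_{e_{l'}}^b[g(ω, v + w)](q) − Δ_{e_l}^aΔ_{e_{l'}}^b[g(ω, v)](q)‖ ≤ (2π/L)^k·Σ_{j≤k} C(k,j)·(j!·(A·j!)·(max(d,1)ρ)ʲ)·W_{k−j}` (`k = a + b`).
[cite: BenfattoGiulianiMastropietro2006, §3 (3.2)–(3.8)] -/
theorem norm_fwdDiff_iter₂_increment_sample_le_of_geometric {g : FreqBand → ℂ} {a b : ℕ}
    (hg : ContDiff ℝ (((a + b : ℕ) : ℕ∞) + 1) g)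
    {v w : EuclideanSpace ℝ (Fin 2) → ℝ} (hv : ContDiff ℝ (↑(a + b : ℕ)) v) (hw : ContDiff ℝ (↑(a + b : ℕ)) w)
    (hperv : ∀ (p : Fin 2 → ℝ) (z : Fin 2 → ℤ), v (WithLp.toLp 2 (fun i => p i + z i * (2 * Real.pi))) = v (WithLp.toLp 2 p))
    (hperw : ∀ (p : Fin 2 → ℝ) (z : Fin 2 → ℤ), w (WithLp.toLp 2 (fun i => p i + z i * (2 * Real.pi))) = w (WithLp.toLp 2 p))
    (ω : ℝ) {A ρ d : ℝ} (hρ : 0 < ρ)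
    (hA : ∀ e : ℝ, ∀ i ≤ a + b, ‖iteratedFDeriv ℝ i (fbDir g fbE1) (fbPt ω e)‖ ≤ A * i ! * ρ ^ i)
    (hD : ∀ s ∈ Icc (0 : ℝ) 1, ∀ i, 1 ≤ i → i ≤ a + b → ∀ x, ‖iteratedFDeriv ℝ i (fun x => v x + s * w x) x‖ ≤ d * ρ ^ (i - 1))
    {W : ℕ → ℝ} (hW : ∀ i ≤ a + b, ∀ x, ‖iteratedFDeriv ℝ i w x‖ ≤ W i) (l l' : Fin 2) (q : TorusSite 2 L) :
    ‖(_root_.fwdDiff (Pi.single l (1 : ZMod L) : TorusSite 2 L))^[a]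
          ((_root_.fwdDiff (Pi.single l' (1 : ZMod L) : TorusSite 2 L))^[b]
            (fun y => g (fbPt ω (v (WithLp.toLp 2 (latticeMomentum L y)) + w (WithLp.toLp 2 (latticeMomentum L y)))))) q -
        (_root_.fwdDiff (Pi.single l (1 : ZMod L) : TorusSite 2 L))^[a]
          ((_root_.fwdDiff (Pi.single l' (1 : ZMod L) : TorusSite 2 L))^[b]
            (fun y => g (fbPt ω (v (WithLp.toLp 2 (latticeMomentum L y)))))) q‖ ≤
      (2 * Real.pi / L) ^ (a + b) *
        ∑ j ∈ Finset.range (a + b + 1), ((a + b).choose j : ℝ) * (j ! * (A * j !) * (max d 1 * ρ) ^ j) * W (a + b - j) := by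
  have hdg : Differentiable ℝ g := hg.differentiable (by exact_mod_cast Nat.succ_ne_zero (a + b))
  have hg1 : ContDiff ℝ (↑(a + b : ℕ)) (fbDir g fbE1) := contDiff_fbDir hg fbE1
  refine norm_fwdDiff_iter₂_comp_fbPt_band_increment_le hdg ω (fun y => v (WithLp.toLp 2 (latticeMomentum L y)))
    (fun y => w (WithLp.toLp 2 (latticeMomentum L y))) _ _ a b q (fun s hs => ?_)
  have h := norm_fwdDiff_iter₂_comp_mul_sample_le_of_geometric (L := L) hg1 (u := fun x => v x + s * w x) (κ := w)
    (hv.add (contDiff_const.mul hw)) hw (fun p z => by simp only [hperv, hperw]) hperw ω hρ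
    (fun x i hi => hA (v x + s * w x) i hi) (hD s (Ico_subset_Icc_self hs)) hW l l' q
  exact h

end Sampling

end Literature.MathematicalPhysics.QuantumLattice

end
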